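import Literature.MathematicalPhysics.QuantumFieldTheory.Balaban1983to89.B9Eq368ProjectionRemainder
import Literature.MathematicalPhysics.QuantumFieldTheory.Balaban1983to89.B9Eq373DerivativeRemainderL2
import Literature.MathematicalPhysics.QuantumFieldTheory.Balaban1983to89.B5Eq172FlatCoercivity

/-!
# `Balaban1983to89.B9Eq384RemainderLetters` — T. Bałaban, *Propagators for lattice gauge theories in a background field*, Commun. Math. Phys.
# **99** (1985) 389–434 [Balaban1985BackgroundPropagators] (3.82)–(3.84) p. 407 *«Δ_a(U′U) = Δ_a(U) − V(A)»*, `V = V₃ + P₁ + P₂`: THE LETTERS OF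
# THE REMAINDER JUNCTION FOR THE pub-balaban NE9 CHAIN — (§1) the remainder of `Δ_a = P + DRD* + aQ†Q` from the remainders of its letters
# (abstract), (§2) the flat transporter letters, (§3) the centre right
# inverse of `Q′(U)` ((3.19) p. 393; independent of `U`) with its bound, (§4) the transporters `R(U(b))` of a small field are close to the
# identity on the fibre ((3.70) p. 404: `R(e^{iηA}) = exp(ηi ad A)`)

statement-level skeleton of published theorems with citation tags; proofs where landed; nothing here is a claim about the Yang–Mills mass gap

PDF held: `paper:balaban1985-cmp99-background-propagators` (journal page = PDF page + 388), pp. 393–394, 404–407, 416; `paper:balaban1984-cmp95-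
propagators-rt-i` p. 22; read by this seat (2026-08-22) in the held text.

THE PRINT (verbatim).  p. 407, (3.82)/(3.84): *«Δ_a(U′U) = D*_{U′U}D_{U′U} + Δ′(U′U) + D_{U′U}R(U′U)D*_{U′U} + Q*(U′U)aQ(U′U) = … = Δ_a(U) − V₃(A) −
P₁(A) − P₂(A) … Let us denote the sum of these three operators by V(A). We can write (3.82) as Δ_a(U′U) = Δ_a(U) − V(A)»*.  p. 393, (3.19):
*«(Q′(V)λ)(y) = Σ_{x∈B(y)} L^{−d} R(V(Γ_{y,x}))λ(x)»* (the contour of the centre is empty).  [B5] p. 22: *«Q′_k transforms constant functions on the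
η-lattice into constant functions on the unit lattice»*.

WHY THIS FILE (cell context).  Third input of the pub-balaban NE9 owner's gen-80 junction `B9Thm311SmallFieldCoercivity` ([B9] Thm 3.11's second
half at a fixed lattice): the letters the assembly needs besides `B9Eq368ProjectionRemainder` (the `R`-part) and `B9Eq373DerivativeRemainderL2`
(the differential parts).

WHAT IS PROVED (sorry-free; no `Prop` placeholder; no inequality of the papers asserted).
* §1 **`norm_laplaceAK_sub_le`**: for `laplaceAK P_i D_i R_i D*_i Q_i Q_i† a` (`i = 1,2`) over finite-dimensional `𝕜`-Hilbert letters,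
  `‖(Δ_a,₂ − Δ_a,₁)x‖ ≤ (δP + 2·MD·δD + MD²·δR + |a|·δQ·(2MQ + δQ))‖x‖` from the remainders `δP, δD, δR, δQ` and bounds `MD, MQ`, `‖R_i z‖ ≤ ‖z‖`.
* §2 `adTransportW_one_apply`/`adTransportW_one_inv_apply`/`hRS_one` (flat letters act as identities).  (The flat injectivity modulus `μ₁` of
  `Δ^η_1` on `N(Q′(1))` — announced for this file — is NE9 leaf-04 gen 69's `B9Eq323FlatBlockPoincare.exists_flat_modulus_explicit`, landed first
  with the EXPLICIT volume-independent constant `2/(L²η²)`; the existential duplicate was withdrawn here.)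
* §3 `centreFun_add`/`centreFun_smul`, **`QprimeW_centre`** (`Q′(U)` of the centre extension returns the coarse function, for EVERY `U`:
  `B9Eq319QprimeTorus.Qprime_centreFun`), `norm_centre_le` (`‖S₀ω‖_{L²} ≤ L^d·√(c₀·#sites)·‖ω‖_∞`, crude).
* §4 **`norm_adTransportW_sub_le`**: `‖R(U(b))w − w‖ ≤ 2M_φM_φ′·ε·‖w‖` when `‖U(b) − 1‖ ≤ ε`, `U(b) ∈ U1` (`uXu⁻¹ − X = (u − 1)Xu⁻¹ + X(u⁻¹ − 1)`,
  `B7Prop1Explicit.norm_inv_sub_one_le`).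
MODEL / DECLARED READINGS.  (M1) as `B9Eq326OperatorAssembly`/`B9Eq315QTorus` (torus `TSite d (L·m)`, fibre `W ≃ 𝔸` along `φ` with bounds `M_φ`,
`M_φ′` of `φ`, `φ⁻¹`, weight `c₀`, scalar `η⁻¹`).  (M2) no displayed hypothesis of the papers in §§2–4; §1 is pure algebra.  (M3) NOT HERE: the
assembly (next file), print's uniform constants.
HONEST SCOPE.  Letters and [folklore] lemmas about the chain's OWN encodings; NOT summit progress (cell pub-balaban: NE9 NOT PRINTED / NOT
PROVED; spine PROVED 0/9).  Filed by the pub-balaban NE9 BINDER-row owner lineage `b2b-balaban-t4-ne9-p1` (gen 80); NEW file importing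
`B9Eq368ProjectionRemainder`, `B9Eq373DerivativeRemainderL2`, `B5Eq172FlatCoercivity`; nothing modified.  Net new unproved facts: 0.
-/

noncomputable section

open scoped InnerProductSpace ComplexConjugate BigOperators

namespace Literature.MathematicalPhysics.QuantumFieldTheory.Balaban1983to89.B9Eq384RemainderLetters

open B4Sect5Torus (TSite)
open B9SectCLatticeCarrier (Bond)
open B7Prop1Explicit (U1 Wcx boxVec)
open B9Eq311L2Pairing (WL2)
open B9Eq319QprimeTorus (fineP centre weight Qprime_centreFun QprimeLin_apply centre_injective)
open B9Eq319Onto (centreFun)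
open B11Eq103H1Complex (SiteL2K BondL2K covDerivL2K covDivL2K covLaplaceSiteK laplaceAK laplaceAK_apply laplaceALatticeK RLatticeK projR
  equiv_covDerivL2K inner_covDivL2K_covDerivL2K)
open B9Eq310HessianOperator (adTransportW adTransportW_apply principalOpK covCurlL2K covCoCurlL2K)
open B9Eq326OperatorAssembly (RofU QprimeW)
open B9Eq315QTorus (perCfg cornerSite QtorusW)
open B5Eq172HodgePositivity (adTransportW_one coercive_of_sub_le)
open B5Eq172FlatCoercivity (QprimeW_one_const hU1_one hreg_one exists_coercive_principal_flat₀)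
open B5Eq172PoincareTorus (const_of_covDeriv_eq_zero)
open B9Eq368ProjectionRemainder (norm_projR_sub_projR_le norm_projR_le exists_modulus_of_ker_inj)
open B9Eq373DerivativeRemainderL2 (norm_adjoint_apply_le norm_covDerivL2K_sub_le norm_covDerivL2K_le norm_covDivL2K_sub_le norm_covDivL2K_le
  norm_covLaplaceSiteK_sub_le norm_covLaplaceSiteK_le norm_principal_sub_le)

/-! ## §1 (3.82)/(3.84) abstractly: the remainder of `Δ_a = P + DRD* + aQ†Q` from the remainders of its letters -/

section Junction

variable {𝕜 : Type*} [RCLike 𝕜] {E S F : Type*} [NormedAddCommGroup E] [InnerProductSpace 𝕜 E] [FiniteDimensional 𝕜 E]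
  [NormedAddCommGroup S] [InnerProductSpace 𝕜 S] [NormedAddCommGroup F] [InnerProductSpace 𝕜 F] [FiniteDimensional 𝕜 F]

/-- **(3.82)∕(3.84) `Δ_a(U′U) = Δ_a(U) − V(A)`, `V = V₃ + P₁ + P₂`, AS A CRUDE BOUND**: the remainder of `laplaceAK P D R D* Q Q† a` between two sets
of letters is controlled by the remainders of `P` (`δP`), of `D`, `D*` (`δD`), of `R` (`δR`), of `Q` (`δQ`) and bounds `MD` of `D₁`, `D*₂`, `MQ` of
`Q₁`, `‖R_i z‖ ≤ ‖z‖`: `‖(Δ_a,₂ − Δ_a,₁)x‖ ≤ (δP + 2·MD·δD + MD²·δR + |a|·δQ·(2MQ + δQ))·‖x‖`.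
[cite: Balaban1985BackgroundPropagators, (3.82)–(3.84) p.407, (3.76) p.405] -/
theorem norm_laplaceAK_sub_le (P₁ P₂ : E →ₗ[𝕜] E) (D₁ D₂ : S →ₗ[𝕜] E) (R₁ R₂ : S →ₗ[𝕜] S) (Ds₁ Ds₂ : E →ₗ[𝕜] S)
    (Q₁ Q₂ : E →ₗ[𝕜] F) (a : ℝ) {δP δD δR δQ MD MQ : ℝ} (hMD : 0 ≤ MD) (hMQ : 0 ≤ MQ) (hδD : 0 ≤ δD) (hδR : 0 ≤ δR) (hδQ : 0 ≤ δQ)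
    (hP : ∀ x, ‖P₂ x - P₁ x‖ ≤ δP * ‖x‖) (hD : ∀ f, ‖D₂ f - D₁ f‖ ≤ δD * ‖f‖) (hDs : ∀ x, ‖Ds₂ x - Ds₁ x‖ ≤ δD * ‖x‖)
    (hD₁ : ∀ f, ‖D₁ f‖ ≤ MD * ‖f‖) (hDs₂ : ∀ x, ‖Ds₂ x‖ ≤ MD * ‖x‖)
    (hR₁ : ∀ z, ‖R₁ z‖ ≤ ‖z‖) (hR₂ : ∀ z, ‖R₂ z‖ ≤ ‖z‖) (hR : ∀ z, ‖R₂ z - R₁ z‖ ≤ δR * ‖z‖)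
    (hQ : ∀ x, ‖Q₂ x - Q₁ x‖ ≤ δQ * ‖x‖) (hQ₁ : ∀ x, ‖Q₁ x‖ ≤ MQ * ‖x‖) (x : E) :
    ‖laplaceAK P₂ D₂ R₂ Ds₂ Q₂ (LinearMap.adjoint Q₂) (a : 𝕜) x - laplaceAK P₁ D₁ R₁ Ds₁ Q₁ (LinearMap.adjoint Q₁) (a : 𝕜) x‖ ≤
      (δP + 2 * MD * δD + MD ^ 2 * δR + |a| * δQ * (2 * MQ + δQ)) * ‖x‖ := by
  have ha : ‖(a : 𝕜)‖ = |a| := RCLike.norm_ofReal a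
  -- the algebraic split
  have hsplit : laplaceAK P₂ D₂ R₂ Ds₂ Q₂ (LinearMap.adjoint Q₂) (a : 𝕜) x - laplaceAK P₁ D₁ R₁ Ds₁ Q₁ (LinearMap.adjoint Q₁) (a : 𝕜) x =
      (P₂ x - P₁ x) + ((D₂ - D₁) (R₂ (Ds₂ x)) + D₁ ((R₂ - R₁) (Ds₂ x)) + D₁ (R₁ ((Ds₂ - Ds₁) x))) +
        (LinearMap.adjoint (Q₂ - Q₁) ((a : 𝕜) • Q₂ x) + LinearMap.adjoint Q₁ ((a : 𝕜) • (Q₂ - Q₁) x)) := by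
    simp only [laplaceAK_apply, LinearMap.sub_apply, map_sub, smul_sub]
    abel
  -- the six pieces
  have h1 := hP x
  have h2 : ‖(D₂ - D₁) (R₂ (Ds₂ x))‖ ≤ δD * (MD * ‖x‖) := by
    rw [LinearMap.sub_apply]
    exact (hD _).trans (mul_le_mul_of_nonneg_left ((hR₂ _).trans (hDs₂ x)) hδD)
  have h3 : ‖D₁ ((R₂ - R₁) (Ds₂ x))‖ ≤ MD * (δR * (MD * ‖x‖)) := by
    refine (hD₁ _).trans (mul_le_mul_of_nonneg_left ?_ hMD)
    rw [LinearMap.sub_apply]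
    exact (hR _).trans (mul_le_mul_of_nonneg_left (hDs₂ x) hδR)
  have h4 : ‖D₁ (R₁ ((Ds₂ - Ds₁) x))‖ ≤ MD * (δD * ‖x‖) := by
    refine (hD₁ _).trans (mul_le_mul_of_nonneg_left ((hR₁ _).trans ?_) hMD)
    rw [LinearMap.sub_apply]; exact hDs x
  have hQ₂ : ‖Q₂ x‖ ≤ (MQ + δQ) * ‖x‖ := by
    have : Q₂ x = Q₁ x + (Q₂ x - Q₁ x) := by abel
    rw [this]
    exact (norm_add_le _ _).trans (by rw [add_mul]; exact add_le_add (hQ₁ x) (hQ x))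
  have h5 : ‖LinearMap.adjoint (Q₂ - Q₁) ((a : 𝕜) • Q₂ x)‖ ≤ δQ * (|a| * ((MQ + δQ) * ‖x‖)) := by
    refine (norm_adjoint_apply_le (Q₂ - Q₁) hδQ (fun y => by rw [LinearMap.sub_apply]; exact hQ y) _).trans ?_
    refine mul_le_mul_of_nonneg_left ?_ hδQ
    rw [norm_smul, ha]
    exact mul_le_mul_of_nonneg_left hQ₂ (abs_nonneg a)
  have h6 : ‖LinearMap.adjoint Q₁ ((a : 𝕜) • (Q₂ - Q₁) x)‖ ≤ MQ * (|a| * (δQ * ‖x‖)) := by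
    refine (norm_adjoint_apply_le Q₁ hMQ hQ₁ _).trans (mul_le_mul_of_nonneg_left ?_ hMQ)
    rw [norm_smul, ha, LinearMap.sub_apply]
    exact mul_le_mul_of_nonneg_left (hQ x) (abs_nonneg a)
  rw [hsplit]
  calc _ ≤ ‖P₂ x - P₁ x‖ + ‖(D₂ - D₁) (R₂ (Ds₂ x)) + D₁ ((R₂ - R₁) (Ds₂ x)) + D₁ (R₁ ((Ds₂ - Ds₁) x))‖ +
        ‖LinearMap.adjoint (Q₂ - Q₁) ((a : 𝕜) • Q₂ x) + LinearMap.adjoint Q₁ ((a : 𝕜) • (Q₂ - Q₁) x)‖ := norm_add₃_le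
    _ ≤ δP * ‖x‖ + (δD * (MD * ‖x‖) + MD * (δR * (MD * ‖x‖)) + MD * (δD * ‖x‖)) +
        (δQ * (|a| * ((MQ + δQ) * ‖x‖)) + MQ * (|a| * (δQ * ‖x‖))) :=
        add_le_add (add_le_add h1 ((norm_add₃_le).trans (add_le_add (add_le_add h2 h3) h4))) ((norm_add_le _ _).trans (add_le_add h5 h6))
    _ = (δP + 2 * MD * δD + MD ^ 2 * δR + |a| * δQ * (2 * MQ + δQ)) * ‖x‖ := by ring

end Junction

/-! ## §2 The flat transporter letters of the NE9 chain act as identities -/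

section FlatModulus

variable {d : ℕ} (L : ℕ) [NeZero L] (m : Fin d → ℕ) [∀ i, NeZero (fineP L m i)]
  {𝔸 : Type*} [NormedRing 𝔸] [NormedAlgebra ℂ 𝔸]
  {W : Type*} [NormedAddCommGroup W] [InnerProductSpace ℂ W] [FiniteDimensional ℂ W] (φ : W ≃ₗ[ℂ] 𝔸) {c₀ : ℝ} [Fact (0 < c₀)]

omit [NeZero L] [∀ i, NeZero (fineP L m i)] [FiniteDimensional ℂ W] in
/-- At the flat background both transporter slots act as the identity and are (trivially) mutually adjoint. [folklore]
[cite: Balaban1985BackgroundPropagators, (3.5) p.391] -/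
theorem adTransportW_one_apply (b : Bond d (fineP L m)) (w : W) : adTransportW φ (fun _ : Bond d (fineP L m) => (1 : 𝔸ˣ)) b w = w := by
  rw [adTransportW_one]; rfl

omit [NeZero L] [∀ i, NeZero (fineP L m i)] [FiniteDimensional ℂ W] in
/-- … the inverse slot too (`1⁻¹ = 1`). [folklore] [cite: Balaban1985BackgroundPropagators, (3.5) p.391] -/
theorem adTransportW_one_inv_apply (b : Bond d (fineP L m)) (w : W) :
    adTransportW φ (fun _ : Bond d (fineP L m) => (1 : 𝔸ˣ)⁻¹) b w = w := by
  simp only [inv_one]; rw [adTransportW_one]; rfl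

omit [NeZero L] [∀ i, NeZero (fineP L m i)] [FiniteDimensional ℂ W] in
/-- flat mutual adjointness. [folklore] [cite: Balaban1985BackgroundPropagators, (3.8) p.392] -/
theorem hRS_one (b : Bond d (fineP L m)) (v u : W) :
    ⟪adTransportW φ (fun _ : Bond d (fineP L m) => (1 : 𝔸ˣ)) b v, u⟫_ℂ = ⟪v, adTransportW φ (fun _ : Bond d (fineP L m) => (1 : 𝔸ˣ)⁻¹) b u⟫_ℂ := by
  rw [adTransportW_one_apply, adTransportW_one_inv_apply]

end FlatModulus

/-! ## §3 The centre right inverse of `Q′(U)` (independent of `U`) -/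

section Centre

variable {d : ℕ} (L : ℕ) [NeZero L] (m : Fin d → ℕ) {𝔸 : Type*} [Ring 𝔸] [Algebra ℂ 𝔸]
  {W : Type*} [NormedAddCommGroup W] [InnerProductSpace ℂ W] (φ : W ≃ₗ[ℂ] 𝔸) {c₀ : ℝ}

/-- the centre extension is additive. [folklore] [cite: Balaban1985BackgroundPropagators, (3.19) p.393] -/
theorem centreFun_add (ω ω' : TSite d m → W) :
    centreFun (weight L m) (centre L m) (ω + ω') = centreFun (weight L m) (centre L m) ω + centreFun (weight L m) (centre L m) ω' := by
  funext x
  simp only [centreFun, Pi.add_apply]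
  split_ifs <;> simp [smul_add]

/-- the centre extension is `ℂ`-homogeneous. [folklore] [cite: Balaban1985BackgroundPropagators, (3.19) p.393] -/
theorem centreFun_smul (r : ℂ) (ω : TSite d m → W) :
    centreFun (weight L m) (centre L m) (r • ω) = r • centreFun (weight L m) (centre L m) ω := by
  funext x
  simp only [centreFun, Pi.smul_apply]
  split_ifs
  · exact smul_comm _ _ _
  · exact (smul_zero _).symm

/-- **`Q′(U)` OF THE CENTRE EXTENSION RETURNS THE COARSE FUNCTION, FOR EVERY `U`** (the contour of a centre is empty):
a right inverse of `Q′(U)` independent of the background. [cite: Balaban1985BackgroundPropagators, (3.19) p.393] -/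
theorem QprimeW_centre (U : Bond d (fineP L m) → 𝔸ˣ) (ω : TSite d m → W) :
    QprimeW L m φ U (c₀ := c₀) ((WL2.equiv ℂ (fun _ : TSite d (fineP L m) => c₀) W).symm (centreFun (weight L m) (centre L m) ω)) = ω := by
  funext y
  rw [QprimeW, LinearMap.comp_apply, QprimeLin_apply]
  simp only [LinearEquiv.coe_coe, WL2.linearEquiv_apply, Equiv.apply_symm_apply]
  exact Qprime_centreFun L m _ ω y

variable [Fact (0 < c₀)]

/-- **THE CENTRE EXTENSION IS BOUNDED from the sup norm into `L²`**: `‖S₀ω‖ ≤ L^d·√(c₀·#sites)·‖ω‖_∞` (crude). [folklore]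
[cite: Balaban1985BackgroundPropagators, (3.19) p.393, (3.11) p.392] -/
theorem norm_centre_le (ω : TSite d m → W) :
    ‖(WL2.equiv ℂ (fun _ : TSite d (fineP L m) => c₀) W).symm (centreFun (weight L m) (centre L m) ω)‖ ≤
      (L : ℝ) ^ d * Real.sqrt (c₀ * Fintype.card (TSite d (fineP L m))) * ‖ω‖ := by
  have hc₀ : 0 < c₀ := Fact.out
  have hpt : ∀ x : TSite d (fineP L m), ‖centreFun (weight L m) (centre L m) ω x‖ ≤ (L : ℝ) ^ d * ‖ω‖ := fun x => by
    unfold centreFun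
    split_ifs with h
    · rw [norm_smul, weight, inv_inv, norm_pow, Real.norm_natCast]
      exact mul_le_mul_of_nonneg_left (norm_le_pi_norm ω _) (by positivity)
    · rw [norm_zero]; positivity
  have hsq : ‖(WL2.equiv ℂ (fun _ : TSite d (fineP L m) => c₀) W).symm (centreFun (weight L m) (centre L m) ω)‖ ^ 2 ≤
      ((L : ℝ) ^ d * Real.sqrt (c₀ * Fintype.card (TSite d (fineP L m))) * ‖ω‖) ^ 2 := by
    rw [WL2.norm_sq]
    simp only [Equiv.apply_symm_apply]
    calc ∑ x : TSite d (fineP L m), c₀ * ‖centreFun (weight L m) (centre L m) ω x‖ ^ 2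
        ≤ ∑ _x : TSite d (fineP L m), c₀ * ((L : ℝ) ^ d * ‖ω‖) ^ 2 :=
          Finset.sum_le_sum fun x _ => mul_le_mul_of_nonneg_left (by have := hpt x; gcongr) hc₀.le
      _ = ((L : ℝ) ^ d * Real.sqrt (c₀ * Fintype.card (TSite d (fineP L m))) * ‖ω‖) ^ 2 := by
          rw [Finset.sum_const, Finset.card_univ, nsmul_eq_mul,
            show ((L : ℝ) ^ d * Real.sqrt (c₀ * Fintype.card (TSite d (fineP L m))) * ‖ω‖) ^ 2 =
              ((L : ℝ) ^ d) ^ 2 * (Real.sqrt (c₀ * Fintype.card (TSite d (fineP L m)))) ^ 2 * ‖ω‖ ^ 2 by ring,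
            Real.sq_sqrt (by positivity)]
          ring
  exact (pow_le_pow_iff_left₀ (norm_nonneg _) (by positivity) two_ne_zero).1 hsq

end Centre

/-! ## §4 The transporters of a small field are close to the identity on the fibre -/

section Transporters

variable {d : ℕ} {Pd : Fin d → ℕ} {𝔸 : Type*} [NormedRing 𝔸] [NormedAlgebra ℂ 𝔸] [NormOneClass 𝔸]
  {W : Type*} [NormedAddCommGroup W] [InnerProductSpace ℂ W] (φ : W ≃ₗ[ℂ] 𝔸) {Mφ Mφ' : ℝ}
  (hφ : ∀ w, ‖φ w‖ ≤ Mφ * ‖w‖) (hφ' : ∀ X, ‖φ.symm X‖ ≤ Mφ' * ‖X‖) (hMφ' : 0 ≤ Mφ')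

include hφ hφ' hMφ' in
/-- **`‖R(U(b))w − w‖ ≤ 2M_φM_φ′·ε·‖w‖` WHEN `‖U(b) − 1‖ ≤ ε`** and `U(b) ∈ U1` (unit-bounded with unit-bounded inverse):
`uXu⁻¹ − X = (u − 1)Xu⁻¹ + X(u⁻¹ − 1)`, `‖u⁻¹ − 1‖ ≤ ‖u − 1‖`.  Print: `R(e^{iηA}) = exp(ηi ad A) = 1 + O(|ηA|)`. [cite: Balaban1985BackgroundPropagators, (3.70) p.404, (3.35) p.397] -/
theorem norm_adTransportW_sub_le (U : Bond d Pd → 𝔸ˣ) (b : Bond d Pd) (hU : U b ∈ U1 𝔸) {ε : ℝ} (hε : ‖(U b : 𝔸) - 1‖ ≤ ε) (w : W) :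
    ‖adTransportW φ U b w - w‖ ≤ 2 * Mφ * Mφ' * ε * ‖w‖ := by
  have hε0 : 0 ≤ ε := (norm_nonneg _).trans hε
  have hinv : ‖(((U b)⁻¹ : 𝔸ˣ) : 𝔸) - 1‖ ≤ ε := (B7Prop1Explicit.norm_inv_sub_one_le hU).trans hε
  have hinv1 : ‖(((U b)⁻¹ : 𝔸ˣ) : 𝔸)‖ ≤ 1 := (B7Prop1Explicit.mem_U1.1 hU).2
  have hsplit : adTransportW φ U b w - w = φ.symm (((U b : 𝔸) - 1) * φ w * (((U b)⁻¹ : 𝔸ˣ) : 𝔸) + φ w * ((((U b)⁻¹ : 𝔸ˣ) : 𝔸) - 1)) := by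
    rw [adTransportW_apply]
    conv_lhs => rw [← φ.symm_apply_apply w]
    rw [← map_sub]
    congr 1
    rw [φ.apply_symm_apply]
    noncomm_ring
  rw [hsplit]
  have hX : ‖φ w‖ ≤ Mφ * ‖w‖ := hφ w
  have hMφw : 0 ≤ Mφ * ‖w‖ := (norm_nonneg _).trans hX
  calc ‖φ.symm (((U b : 𝔸) - 1) * φ w * (((U b)⁻¹ : 𝔸ˣ) : 𝔸) + φ w * ((((U b)⁻¹ : 𝔸ˣ) : 𝔸) - 1))‖
      ≤ Mφ' * ‖((U b : 𝔸) - 1) * φ w * (((U b)⁻¹ : 𝔸ˣ) : 𝔸) + φ w * ((((U b)⁻¹ : 𝔸ˣ) : 𝔸) - 1)‖ := hφ' _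
    _ ≤ Mφ' * (ε * (Mφ * ‖w‖) * 1 + Mφ * ‖w‖ * ε) := by
        refine mul_le_mul_of_nonneg_left ((norm_add_le _ _).trans (add_le_add ?_ ?_)) hMφ'
        · exact (norm_mul_le _ _).trans (mul_le_mul ((norm_mul_le _ _).trans (mul_le_mul hε hX (norm_nonneg _) hε0)) hinv1
            (norm_nonneg _) (by positivity))
        · exact (norm_mul_le _ _).trans (mul_le_mul hX hinv (norm_nonneg _) hMφw)
    _ = 2 * Mφ * Mφ' * ε * ‖w‖ := by ring

end Transporters

end Literature.MathematicalPhysics.QuantumFieldTheory.Balaban1983to89.B9Eq384RemainderLetters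

end
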